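import Summits.QuantumFields.YangMills.Theorems.BalabanUVNodesN16HolderMSOfLeafL1
import Literature.MathematicalPhysics.QuantumFieldTheory.Balaban1983to89.B8LeafKnitZd3E
import HarnessLib

/-!
# Route «BalabanUVNodes» (K3⁗ `SpineGivenEndpointR13Sep`), DAG node N16 = NE3 — THE N05 → N16 EDGE KEYED AT NODE N05's SOCKET FRONTIER: n05-a's five
# un-sourced sockets (`SockP5base`, `SockP5`, `SockH59`, `SockP5uE`, `SockB9P3`) on the univ sub-family of `zdGF3 (M_n ℂ) L β len` + N07's (H3ˢᵘᵖ)
# ⟹ the root of record (β = 1) and the multi-scale β-root (R-β″) — Theorem 8's source-space typing (p501857) nowhere on the path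

Cell `pub-ymgap`, seat `pub-ymgap-dag-n16-c` (R134 fan-out seat, strategy s1; HUMAN RULING D-0062; chair R424 venue), generation 5, file 42 — over n05-a's
`B8LeafKnitZd3E.thm4Printed_zd3_mapE` (Theorem 4 p. 88 on an index-mapped sub-family from the four Prop-5 ∕ (1.59) sockets on its image, repaired uniqueness socket
`SockP5uE`) and `B8LeafModelZd3Map.prop3Printed_zd3_map` (Proposition 3 p. 87 from the Prop-3-frame b9 socket), generation 0's `N16.OfLeaf` (`n16_of_leaf`,
`exists_window_print`) and generation 4's `N16HolderMSOfLeafTop.n16_holderMS_of_leaf`.  `--supports stmt-QuantumFields-20292 --as helper` (K3⁗, dag-lead WORDS-140).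
`bears_on: R4∕N16 · edge N05 → N16`.

WHY.  After n05-c's certificate (p501857: the leaf-of-record SHAPE `B8LeafRS` is uninhabited on the univ sub-family of `zdGF3`, through Theorem 8's typed source space)
the honest N05 → N16 edge must avoid the leaf SHAPE.  Node N05's typed frontier for what N16 reads is n05-a's pair of knits: Theorem 4 and Proposition 3 on `zdGF3`
MODULO five named sockets per member, required on the univ sub-family only (`ι := Subtype.val`).  THIS FILE composes them with N16's END: sockets on the univ members +
side letters (`0 < B₀`, `B₀ ≥ inp.B₀`, `0 < B₀′`, `2 ≤ 5·4·L·B₀`, `0 < cu`, `0 < cP`, `0 ≤ B₀β`, `2097152·(4+1)² ≤ C₂`) + N07's `LeafH3sup` + THE END's letters ⟹ N16's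
root, at β = 1 (`NE3EnergyRateWCov`, the decl of record) and at any `β ∈ [0,1]` (`CovRootHolderMS`, print's ℓ¹ length).  Nothing on this path reads `Src` ∕ `InR`.

WHAT THIS FILE PROVES (kernel, theorems only, 0 `def`, 0 sorry): `n16_of_socketsZd3E` (β = 1), `n16_holderMS_of_socketsZd3E_l1Len` (R-β″ at `len := l1Len`),
`n16_holderMS_of_socketsHFP₄_l1Len` (the same in the providers' PLAIN FIXED-POINT currency `SockHFP₀ ∕ SockHFP` with four independent thresholds —
n05-a's `thm4Printed_zd3_of_HFP₄_mapE`).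
HONEST FRAMING: a knit by name; the five sockets are node N05's ∕ N04's ∕ N06's open obligations ([Balaban1985RegularSpaces] Prop 5 both halves, (1.59) =
[Balaban1985BackgroundPropagators] Thm 3.3 in two frames) — HYPOTHESES here, displayed per univ member; (H3ˢᵘᵖ) = N07's [Balaban1985Variational] Thm 1 TYPE;
nothing of Bałaban is proved; N16 ∕ NE3 NOT discharged; count-neutral; one finite four-torus at fixed ε — NOT ℝ⁴, NOT infinite volume, NOT OS, NOT a mass gap, NOT Clay.
-/

set_option autoImplicit false

open scoped BigOperators Matrix Matrix.Norms.L2Operator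
open NormedSpace

namespace Summit.QuantumFields.YangMills.BalabanUVNodes.N16OfSocketsZd3

open Literature.MathematicalPhysics.QuantumFieldTheory.Balaban1983to89
open B7Prop1Explicit B7Prop2Explicit
open B7Prop3Flat (c3)
open B8LeafModelZd (ZdIdx SockP5base SockP5 SockH59)
open B8LeafModelZd3 (zdGF3 SockB9P3)
open B8LeafModelZdSockP5uE (SockP5uE)
open B8LeafModelZdOfHFP (SockHFP₀ SockHFP)
open Summit.QuantumFields.BalabanUV.T4Continuum
open BlockAverageCurrent (curConst)
open NE3EnergyWeightedCovShape (NE3EnergyRateWCov)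
open NE3RightInverseSupLetters (frameC)
open NE3.LeafIndexSockets (LeafH3sup)
open MinimalActionRate (sfClass)
open Summit.QuantumFields.YangMills.BalabanUVNodes.N16HolderMSDefs (CovRootHolderMS)
open Summit.QuantumFields.YangMills.BalabanUVNodes.N16.OfLeaf (exists_window_print n16_of_leaf)
open Summit.QuantumFields.YangMills.BalabanUVNodes.N16HolderMSOfLeafTop (n16_holderMS_of_leaf)
open Summit.QuantumFields.YangMills.BalabanUVNodes.N16HolderMSOfLeafL1 (l1Len_nsmul_e)
open B9Eq340HolderZd (l1Len one_le_l1Len)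

noncomputable section

section Matrices

variable {n : Type} [Fintype n] [DecidableEq n]

/-- **N16 · NE3 (β = 1, THE DECL OF RECORD's ROOT) FROM NODE N05's FIVE SOCKETS ON THE UNIV SUB-FAMILY OF `zdGF3 (M_n(ℂ)) L 1 len` AND N07's (H3ˢᵘᵖ)** (`d = 4`,
`L ≥ 2`, `N ≥ 1`; `𝔸 = M_n(ℂ)` with the `L²`-operator-norm C⋆-structure).  `∃ r > 0, ∀ g > 0, ∃ C ≥ 0` (THE END's), then for all socket letters `C₂ B₀ B₀′ cu cP inp B₀β`,
a length function `len ≥ 1` on its support with `len e_μ = 1`, side letters `0 < B₀`, `inp.B₀ ≤ B₀`, `0 < B₀′`, `2 ≤ 5·4·L·B₀`, `0 < cu`, `0 < cP`, `0 ≤ B₀β`,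
`2097152·(4+1)² ≤ C₂`, and n05-a's five sockets AT EVERY UNIV MEMBER `i` (`SockP5base ∕ SockP5 ∕ SockH59 ∕ SockP5uE ∕ SockB9P3` at `i.1`): a window threshold `c₁′ > 0`
with `16·(5·4·L·inp.B₀)·c₁′ ≤ 1` and generation 0's file 5 §3 tail verbatim, ending in `LeafH3sup 4 L N ε b′ c′ dom → NE3EnergyRateWCov 4 (sfClass 4 L N ε) L N b g C s₁ s₂
dom`.  n05-a's `thm4Printed_zd3_mapE` ∕ `prop3Printed_zd3_map` at `ι := Subtype.val` ∘ `n16_of_leaf`.  N16 ∕ NE3 NOT proved: the sockets are node N05's open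
obligations, (H3ˢᵘᵖ) is N07's. [cite: Balaban1985RegularSpaces, Thm 4 p.88, Prop. 3 p.87, Prop. 5 p.94, (1.59) p.86] [folklore] -/
theorem n16_of_socketsZd3E [Nonempty n] {L N : ℕ} (hL : 2 ≤ L) (hN : 1 ≤ N) :
    letI : CStarAlgebra (Matrix n n ℂ) := {}
    ∃ r : ℝ, 0 < r ∧ ∀ ⦃g : ℝ⦄, 0 < g → ∃ C : ℝ, 0 ≤ C ∧
      ∀ (C₂ B₀ B₀' cu cP : ℝ) (inp : B8.B9Inputs) (B₀β : ℝ) (len : Site 4 → ℝ),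
      (∀ v : Site 4, 0 < len v → 1 ≤ len v) → (∀ μ : Fin 4, len (e μ) = 1) →
      0 < B₀ → inp.B₀ ≤ B₀ → 0 < B₀' → 2 ≤ 5 * ((4 : ℕ) : ℝ) * L * B₀ → 0 < cu → 0 < cP → 0 ≤ B₀β →
      2097152 * (((4 : ℕ) : ℝ) + 1) ^ 2 ≤ C₂ →
      (∀ i : {i : ZdIdx 4 L // i.Ω 0 = Set.univ}, SockP5base (𝔸 := Matrix n n ℂ) L B₀ B₀' cP i.1.η i.1.k i.1.Ω i.1.Λs) →
      (∀ i : {i : ZdIdx 4 L // i.Ω 0 = Set.univ}, SockP5 (𝔸 := Matrix n n ℂ) L B₀ B₀' cP i.1.η i.1.k i.1.Ω i.1.Λs) →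
      (∀ i : {i : ZdIdx 4 L // i.Ω 0 = Set.univ}, SockH59 (𝔸 := Matrix n n ℂ) L B₀ B₀' cP i.1.η i.1.k i.1.Ω i.1.Λs i.1.Λb) →
      (∀ i : {i : ZdIdx 4 L // i.Ω 0 = Set.univ}, SockP5uE (𝔸 := Matrix n n ℂ) L B₀ cP cu i.1.η i.1.k i.1.Ω i.1.Λs) →
      (∀ i : {i : ZdIdx 4 L // i.Ω 0 = Set.univ}, SockB9P3 (𝔸 := Matrix n n ℂ) L inp.B₀ B₀β cP 1 len i.1.η i.1.k i.1.Ω i.1.Λs i.1.Λb) →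
      ∃ c₁' : ℝ, 0 < c₁' ∧ 16 * (5 * ((4 : ℕ) : ℝ) * L * inp.B₀ * c₁') ≤ 1 ∧
      ∀ ⦃b' c' : ℝ⦄, 0 ≤ b' → 0 ≤ c' →
      2 ^ 15 * ((4 : ℝ) + 1) ^ 2 * ((4 : ℝ) + 4) ^ 2 * (L : ℝ) ^ 2 * b' ≤ 1 →
      23040 * (4 : ℝ) ^ 4 * (frameC 4 L + 4) ^ 3 * (c' + curConst 4 L * b' ^ 2) ≤ 1 →
      ∀ ⦃α : ℝ⦄, 0 < α → C0 4 * α ≤ 1 / 3 → 2 * α ≤ c2' 4 L → 11 * (4 : ℝ) ^ 2 * α ≤ 1 / 6 → α + 11 * (4 : ℝ) ^ 2 * α ≤ c₁' →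
      b' + 226 * (8 * ((4 : ℝ) + 1) * ((4 : ℝ) + 4)) ^ 2 * b' ^ 2 < α → 4 * ((4 : ℝ) - 1) * (c' + curConst 4 L * b' ^ 2) < α →
      ∀ ⦃Mc : ℝ⦄, 0 ≤ Mc → (Mc + 1) * (b' + 226 * (8 * ((4 : ℝ) + 1) * ((4 : ℝ) + 4)) ^ 2 * b' ^ 2) ≤ 1 / 2 →
      ∀ (𝒬 : ℕ → Set (Set (Site 4) × ℕ)), (∀ k, ∀ q ∈ 𝒬 k, q.2 ≤ k ∧ ∃ y : Site 4, ∀ z ∈ q.1, (l1 (z - y) : ℝ) ≤ Mc * (L : ℝ) ^ q.2) →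
      ∀ ⦃C335 : ℝ⦄, 2 * (Mc + 1) * (b' + 226 * (8 * ((4 : ℝ) + 1) * ((4 : ℝ) + 4)) ^ 2 * b' ^ 2) + 2 * Mc * (2 * (c' + curConst 4 L * b' ^ 2)) +
        4 * Mc * (1 + 2 * Mc) * (b' + 226 * (8 * ((4 : ℝ) + 1) * ((4 : ℝ) + 4)) ^ 2 * b' ^ 2) ^ 2 < C335 →
      ∀ ⦃ε s₁ b s₂ : ℝ⦄, 0 < ε → ε ≤ r → ε < α → 0 ≤ s₁ → s₁ ≤ r → 0 ≤ b → b ≤ ε / 2 →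
      5 * ((4 : ℕ) : ℝ) * L * inp.B₀ * (α + 11 * (4 : ℝ) ^ 2 * α) ≤ s₁ →
      5 * ((4 : ℕ) : ℝ) * L * inp.B₀ * (α + 11 * (4 : ℝ) ^ 2 * α) +
          2 * (b' + 226 * (8 * ((4 : ℝ) + 1) * ((4 : ℝ) + 4)) ^ 2 * b' ^ 2) * s₁ ≤ s₁ →
      5 * ((4 : ℕ) : ℝ) * L * inp.B₀ * (α + 11 * (4 : ℝ) ^ 2 * α) + 16 * (b' + 226 * (8 * ((4 : ℝ) + 1) * ((4 : ℝ) + 4)) ^ 2 * b' ^ 2) *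
          (5 * ((4 : ℕ) : ℝ) * L * inp.B₀ * (α + 11 * (4 : ℝ) ^ 2 * α)) ≤ s₁ →
      5 * ((4 : ℕ) : ℝ) * L * B₀β * (α + 11 * (4 : ℝ) ^ 2 * α) + 8 * (b' + 226 * (8 * ((4 : ℝ) + 1) * ((4 : ℝ) + 4)) ^ 2 * b' ^ 2) *
          (5 * ((4 : ℕ) : ℝ) * L * inp.B₀ * (α + 11 * (4 : ℝ) ^ 2 * α)) ≤ s₂ →
      ∀ {dom : _root_.Set (Site 4 → Fin 4 → (Matrix n n ℂ)ˣ)},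
        LeafH3sup 4 L N ε b' c' dom →
        NE3EnergyRateWCov 4 (sfClass 4 L N ε) L N b g C s₁ s₂ dom := by
  letI : CStarAlgebra (Matrix n n ℂ) := {}
  obtain ⟨r, hr0, hr⟩ := n16_of_leaf (n := n) hL hN
  refine ⟨r, hr0, fun g hg => ?_⟩
  obtain ⟨C, hC0, hC⟩ := hr hg
  refine ⟨C, hC0, fun C₂ B₀ B₀' cu cP inp B₀β len hlen hlen1 hB₀ hiB hB₀' hB hcu hcP hB₀β hC₂ SP5base SP5 SH59 SP5u SB9 => ?_⟩
  -- node N05's Theorem 4 ∕ Proposition 3 on the univ sub-family from the sockets there (n05-a, `ι := Subtype.val`)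
  obtain ⟨c₁t, hc₁t, hT⟩ := B8LeafKnitZd3E.thm4Printed_zd3_mapE (𝔸 := Matrix n n ℂ) (d := 4) (by norm_num) hL (β := (1 : ℝ))
    (len := len) hB₀ hB₀' hB hcu hcP (fun i : {i : ZdIdx 4 L // i.Ω 0 = Set.univ} => i.1) SP5base SP5 SH59 SP5u
  obtain ⟨cP', hcP', hP⟩ := B8LeafModelZd3Map.prop3Printed_zd3_map (𝔸 := Matrix n n ℂ) (d := 4) (by norm_num) hL inp hB₀β hC₂ hcP
    (1 : ℝ) len (fun i : {i : ZdIdx 4 L // i.Ω 0 = Set.univ} => i.1) SB9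
  -- the letter `B₁′ := 5·4·L·B₀` and the window threshold below the two printed thresholds
  have hLpos : (0 : ℝ) < L := by exact_mod_cast (show 0 < L by omega)
  have hB₁' : 0 < 5 * ((4 : ℕ) : ℝ) * L * B₀ := by positivity
  have hBB : 5 * ((4 : ℕ) : ℝ) * L * inp.B₀ ≤ 5 * ((4 : ℕ) : ℝ) * L * B₀ := mul_le_mul_of_nonneg_left hiB (by positivity)
  obtain ⟨c₁', hc₁', hwin⟩ := exists_window_print (d := 4) (L := L) (by norm_num) hL C₂ hc₁t hcP' hB₁'
  have h16 : 16 * (5 * ((4 : ℕ) : ℝ) * L * inp.B₀ * c₁') ≤ 1 := by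
    obtain ⟨-, -, -, h, -⟩ := hwin (c₁' / 2) (c₁' / 2) (by linarith) (by linarith) (by linarith)
    have h' : 16 * (5 * ((4 : ℕ) : ℝ) * L * B₀ * c₁') ≤ 1 := by rwa [add_halves] at h
    nlinarith [mul_le_mul_of_nonneg_right hBB hc₁'.le]
  refine ⟨c₁', hc₁', h16, fun b' c' hb' hc' hRb hcF α hα hA3 hA2 hAs hAc hb'α hc'α Mc hMc hMcα 𝒬 h𝒬 C335 hC335 ε s₁ b s₂ hε hεr hεα hs₁
    hs₁r hb hbh hss hgrad hℓ hhol dom h3 => ?_⟩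
  exact hC c₁t c₁' (5 * ((4 : ℕ) : ℝ) * L * B₀) cP' C₂ B₀β inp len hlen hlen1 hB₁' hBB h16 hwin hb' hc' hRb hcF hα hA3 hA2 hAs hAc hb'α hc'α
    hMc hMcα 𝒬 h𝒬 hC335 hε hεr hεα hs₁ hs₁r hb hbh hss hgrad hℓ hhol hT hP h3

/-- ★ **N16 · THE MULTI-SCALE β-ROOT FROM NODE N05's FIVE SOCKETS ON THE UNIV SUB-FAMILY OF `zdGF3 (M_n(ℂ)) L β l1Len` AND N07's (H3ˢᵘᵖ)** (`d = 4`, `L ≥ 2`,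
`N ≥ 1`, ANY `β ∈ [0, 1]` — node N05's residual Hölder exponent; print's ℓ¹ length `B9Eq340HolderZd.l1Len`, both length letters discharged; repair R-β″).  `∃ r > 0, ∀ g > 0,
∃ C ≥ 0`, then for all `β ∈ [0,1]`, socket letters, side letters as in `n16_of_socketsZd3E`, and n05-a's five sockets AT EVERY UNIV MEMBER (`SockB9P3` at the Hölder
datum `(β, l1Len)`): `∃ c₁′ > 0` with `16·(5·4·L·inp.B₀)·c₁′ ≤ 1` and generation 4's file 36 §2 tail verbatim (Hölder threshold `B_h·s + 10·α_{b′}·B·s ≤ s₂`), ending in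
`LeafH3sup 4 L N ε b′ c′ dom → CovRootHolderMS 4 (sfClass 4 L N ε) L N b g C s₁ s₂ β dom`.  n05-a's `thm4Printed_zd3_mapE` ∕ `prop3Printed_zd3_map` at `ι := Subtype.val` ∘
`n16_holderMS_of_leaf`.  N16 ∕ NE3 NOT proved: the sockets are node N05's open obligations, (H3ˢᵘᵖ) is N07's.
[cite: Balaban1985RegularSpaces, Thm 4 p.88, Prop. 3 p.87, Prop. 5 p.94, (1.59) p.86, (1.36) p.82; Balaban1985BackgroundPropagators, (3.40) p.397] [folklore] -/
theorem n16_holderMS_of_socketsZd3E_l1Len [Nonempty n] {L N : ℕ} (hL : 2 ≤ L) (hN : 1 ≤ N) :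
    letI : CStarAlgebra (Matrix n n ℂ) := {}
    ∃ r : ℝ, 0 < r ∧ ∀ ⦃g : ℝ⦄, 0 < g → ∃ C : ℝ, 0 ≤ C ∧
      ∀ ⦃β : ℝ⦄, 0 ≤ β → β ≤ 1 → ∀ (C₂ B₀ B₀' cu cP : ℝ) (inp : B8.B9Inputs) (B₀β : ℝ),
      0 < B₀ → inp.B₀ ≤ B₀ → 0 < B₀' → 2 ≤ 5 * ((4 : ℕ) : ℝ) * L * B₀ → 0 < cu → 0 < cP → 0 ≤ B₀β →
      2097152 * (((4 : ℕ) : ℝ) + 1) ^ 2 ≤ C₂ →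
      (∀ i : {i : ZdIdx 4 L // i.Ω 0 = Set.univ}, SockP5base (𝔸 := Matrix n n ℂ) L B₀ B₀' cP i.1.η i.1.k i.1.Ω i.1.Λs) →
      (∀ i : {i : ZdIdx 4 L // i.Ω 0 = Set.univ}, SockP5 (𝔸 := Matrix n n ℂ) L B₀ B₀' cP i.1.η i.1.k i.1.Ω i.1.Λs) →
      (∀ i : {i : ZdIdx 4 L // i.Ω 0 = Set.univ}, SockH59 (𝔸 := Matrix n n ℂ) L B₀ B₀' cP i.1.η i.1.k i.1.Ω i.1.Λs i.1.Λb) →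
      (∀ i : {i : ZdIdx 4 L // i.Ω 0 = Set.univ}, SockP5uE (𝔸 := Matrix n n ℂ) L B₀ cP cu i.1.η i.1.k i.1.Ω i.1.Λs) →
      (∀ i : {i : ZdIdx 4 L // i.Ω 0 = Set.univ}, SockB9P3 (𝔸 := Matrix n n ℂ) L inp.B₀ B₀β cP β l1Len i.1.η i.1.k i.1.Ω i.1.Λs i.1.Λb) →
      ∃ c₁' : ℝ, 0 < c₁' ∧ 16 * (5 * ((4 : ℕ) : ℝ) * L * inp.B₀ * c₁') ≤ 1 ∧
      ∀ ⦃b' c' : ℝ⦄, 0 ≤ b' → 0 ≤ c' →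
      2 ^ 15 * ((4 : ℝ) + 1) ^ 2 * ((4 : ℝ) + 4) ^ 2 * (L : ℝ) ^ 2 * b' ≤ 1 →
      23040 * (4 : ℝ) ^ 4 * (frameC 4 L + 4) ^ 3 * (c' + curConst 4 L * b' ^ 2) ≤ 1 →
      ∀ ⦃α : ℝ⦄, 0 < α → C0 4 * α ≤ 1 / 3 → 2 * α ≤ c2' 4 L → 11 * (4 : ℝ) ^ 2 * α ≤ 1 / 6 → α + 11 * (4 : ℝ) ^ 2 * α ≤ c₁' →
      b' + 226 * (8 * ((4 : ℝ) + 1) * ((4 : ℝ) + 4)) ^ 2 * b' ^ 2 < α → 4 * ((4 : ℝ) - 1) * (c' + curConst 4 L * b' ^ 2) < α →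
      ∀ ⦃Mc : ℝ⦄, 0 ≤ Mc → (Mc + 1) * (b' + 226 * (8 * ((4 : ℝ) + 1) * ((4 : ℝ) + 4)) ^ 2 * b' ^ 2) ≤ 1 / 2 →
      ∀ (𝒬 : ℕ → Set (Set (Site 4) × ℕ)), (∀ k, ∀ q ∈ 𝒬 k, q.2 ≤ k ∧ ∃ y : Site 4, ∀ z ∈ q.1, (l1 (z - y) : ℝ) ≤ Mc * (L : ℝ) ^ q.2) →
      ∀ ⦃C335 : ℝ⦄, 2 * (Mc + 1) * (b' + 226 * (8 * ((4 : ℝ) + 1) * ((4 : ℝ) + 4)) ^ 2 * b' ^ 2) + 2 * Mc * (2 * (c' + curConst 4 L * b' ^ 2)) +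
        4 * Mc * (1 + 2 * Mc) * (b' + 226 * (8 * ((4 : ℝ) + 1) * ((4 : ℝ) + 4)) ^ 2 * b' ^ 2) ^ 2 < C335 →
      ∀ ⦃ε s₁ b s₂ : ℝ⦄, 0 < ε → ε ≤ r → ε < α → 0 ≤ s₁ → s₁ ≤ r → 0 ≤ b → b ≤ ε / 2 →
      5 * ((4 : ℕ) : ℝ) * L * inp.B₀ * (α + 11 * (4 : ℝ) ^ 2 * α) ≤ s₁ →
      5 * ((4 : ℕ) : ℝ) * L * inp.B₀ * (α + 11 * (4 : ℝ) ^ 2 * α) +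
          2 * (b' + 226 * (8 * ((4 : ℝ) + 1) * ((4 : ℝ) + 4)) ^ 2 * b' ^ 2) * s₁ ≤ s₁ →
      5 * ((4 : ℕ) : ℝ) * L * inp.B₀ * (α + 11 * (4 : ℝ) ^ 2 * α) + 16 * (b' + 226 * (8 * ((4 : ℝ) + 1) * ((4 : ℝ) + 4)) ^ 2 * b' ^ 2) *
          (5 * ((4 : ℕ) : ℝ) * L * inp.B₀ * (α + 11 * (4 : ℝ) ^ 2 * α)) ≤ s₁ →
      5 * ((4 : ℕ) : ℝ) * L * B₀β * (α + 11 * (4 : ℝ) ^ 2 * α) + 10 * (b' + 226 * (8 * ((4 : ℝ) + 1) * ((4 : ℝ) + 4)) ^ 2 * b' ^ 2) *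
          (5 * ((4 : ℕ) : ℝ) * L * inp.B₀ * (α + 11 * (4 : ℝ) ^ 2 * α)) ≤ s₂ →
      ∀ {dom : _root_.Set (Site 4 → Fin 4 → (Matrix n n ℂ)ˣ)},
        LeafH3sup 4 L N ε b' c' dom →
        CovRootHolderMS 4 (sfClass 4 L N ε) L N b g C s₁ s₂ β dom := by
  letI : CStarAlgebra (Matrix n n ℂ) := {}
  obtain ⟨r, hr0, hr⟩ := n16_holderMS_of_leaf (n := n) hL hN
  refine ⟨r, hr0, fun g hg => ?_⟩
  obtain ⟨C, hC0, hC⟩ := hr hg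
  refine ⟨C, hC0, fun β hβ0 hβ1 C₂ B₀ B₀' cu cP inp B₀β hB₀ hiB hB₀' hB hcu hcP hB₀β hC₂ SP5base SP5 SH59 SP5u SB9 => ?_⟩
  -- node N05's Theorem 4 ∕ Proposition 3 on the univ sub-family from the sockets there (n05-a, `ι := Subtype.val`)
  obtain ⟨c₁t, hc₁t, hT⟩ := B8LeafKnitZd3E.thm4Printed_zd3_mapE (𝔸 := Matrix n n ℂ) (d := 4) (by norm_num) hL (β := β)
    (len := l1Len) hB₀ hB₀' hB hcu hcP (fun i : {i : ZdIdx 4 L // i.Ω 0 = Set.univ} => i.1) SP5base SP5 SH59 SP5u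
  obtain ⟨cP', hcP', hP⟩ := B8LeafModelZd3Map.prop3Printed_zd3_map (𝔸 := Matrix n n ℂ) (d := 4) (by norm_num) hL inp hB₀β hC₂ hcP
    β l1Len (fun i : {i : ZdIdx 4 L // i.Ω 0 = Set.univ} => i.1) SB9
  -- the letter `B₁′ := 5·4·L·B₀` and the window threshold below the two printed thresholds
  have hLpos : (0 : ℝ) < L := by exact_mod_cast (show 0 < L by omega)
  have hB₁' : 0 < 5 * ((4 : ℕ) : ℝ) * L * B₀ := by positivity
  have hBB : 5 * ((4 : ℕ) : ℝ) * L * inp.B₀ ≤ 5 * ((4 : ℕ) : ℝ) * L * B₀ := mul_le_mul_of_nonneg_left hiB (by positivity)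
  obtain ⟨c₁', hc₁', hwin⟩ := exists_window_print (d := 4) (L := L) (by norm_num) hL C₂ hc₁t hcP' hB₁'
  have h16 : 16 * (5 * ((4 : ℕ) : ℝ) * L * inp.B₀ * c₁') ≤ 1 := by
    obtain ⟨-, -, -, h, -⟩ := hwin (c₁' / 2) (c₁' / 2) (by linarith) (by linarith) (by linarith)
    have h' : 16 * (5 * ((4 : ℕ) : ℝ) * L * B₀ * c₁') ≤ 1 := by rwa [add_halves] at h
    nlinarith [mul_le_mul_of_nonneg_right hBB hc₁'.le]
  refine ⟨c₁', hc₁', h16, fun b' c' hb' hc' hRb hcF α hα hA3 hA2 hAs hAc hb'α hc'α Mc hMc hMcα 𝒬 h𝒬 C335 hC335 ε s₁ b s₂ hε hεr hεα hs₁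
    hs₁r hb hbh hss hgrad hℓ hhol dom h3 => ?_⟩
  exact hC c₁t c₁' (5 * ((4 : ℕ) : ℝ) * L * B₀) cP' C₂ B₀β inp l1Len (fun v hv => one_le_l1Len hv) l1Len_nsmul_e hB₁' hBB h16 hwin hb' hc'
    hRb hcF hα hA3 hA2 hAs hAc hb'α hc'α hMc hMcα 𝒬 h𝒬 hC335 hε hεr hεα hs₁ hs₁r hb hbh hss hgrad hℓ hhol hβ0 hβ1 hT hP h3

/-- ★ **THE SAME IN THE PROVIDERS' CURRENCY: PLAIN FIXED-POINT SOCKETS WITH FOUR INDEPENDENT THRESHOLDS** (`d = 4`, `L ≥ 2`, `N ≥ 1`, any `β ∈ [0,1]`, `len := l1Len`)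
— `n16_holderMS_of_socketsZd3E_l1Len` with the Proposition-5 existence pair in the form n04-b's providers deliver (`SockHFP₀` at `cF₀`, `SockHFP` at `cF`), (1.59) at
`c59`, uniqueness `SockP5uE` at `(cu′, cu)`, the Prop-3-frame b9 socket at `cP` (n05-a's `B8LeafKnitZd3E.thm4Printed_zd3_of_HFP₄_mapE` in place of `thm4Printed_zd3_mapE`).
N16 ∕ NE3 NOT proved: the sockets are node N05's open obligations, (H3ˢᵘᵖ) is N07's.
[cite: Balaban1985RegularSpaces, Thm 4 p.88 («there exists a constant c₁»), Prop. 3 p.87, Prop. 5 (1.106)–(1.109) p.94, (1.59) p.86; Balaban1985BackgroundPropagators, (3.40) p.397] [folklore] -/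
theorem n16_holderMS_of_socketsHFP₄_l1Len [Nonempty n] {L N : ℕ} (hL : 2 ≤ L) (hN : 1 ≤ N) :
    letI : CStarAlgebra (Matrix n n ℂ) := {}
    ∃ r : ℝ, 0 < r ∧ ∀ ⦃g : ℝ⦄, 0 < g → ∃ C : ℝ, 0 ≤ C ∧
      ∀ ⦃β : ℝ⦄, 0 ≤ β → β ≤ 1 → ∀ (C₂ B₀ B₀' cu cF₀ cF c59 cu' cP : ℝ) (inp : B8.B9Inputs) (B₀β : ℝ),
      0 < B₀ → inp.B₀ ≤ B₀ → 0 < B₀' → 2 ≤ 5 * ((4 : ℕ) : ℝ) * L * B₀ → 0 < cu → 0 < cF₀ → 0 < cF → 0 < c59 → 0 < cu' → 0 < cP →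
      0 ≤ B₀β → 2097152 * (((4 : ℕ) : ℝ) + 1) ^ 2 ≤ C₂ →
      (∀ i : {i : ZdIdx 4 L // i.Ω 0 = Set.univ}, SockHFP₀ (𝔸 := Matrix n n ℂ) L B₀ B₀' cF₀ i.1.η i.1.k i.1.Ω i.1.Λs) →
      (∀ i : {i : ZdIdx 4 L // i.Ω 0 = Set.univ}, SockHFP (𝔸 := Matrix n n ℂ) L B₀ B₀' cF i.1.η i.1.k i.1.Ω i.1.Λs) →
      (∀ i : {i : ZdIdx 4 L // i.Ω 0 = Set.univ}, SockH59 (𝔸 := Matrix n n ℂ) L B₀ B₀' c59 i.1.η i.1.k i.1.Ω i.1.Λs i.1.Λb) →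
      (∀ i : {i : ZdIdx 4 L // i.Ω 0 = Set.univ}, SockP5uE (𝔸 := Matrix n n ℂ) L B₀ cu' cu i.1.η i.1.k i.1.Ω i.1.Λs) →
      (∀ i : {i : ZdIdx 4 L // i.Ω 0 = Set.univ}, SockB9P3 (𝔸 := Matrix n n ℂ) L inp.B₀ B₀β cP β l1Len i.1.η i.1.k i.1.Ω i.1.Λs i.1.Λb) →
      ∃ c₁' : ℝ, 0 < c₁' ∧ 16 * (5 * ((4 : ℕ) : ℝ) * L * inp.B₀ * c₁') ≤ 1 ∧
      ∀ ⦃b' c' : ℝ⦄, 0 ≤ b' → 0 ≤ c' →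
      2 ^ 15 * ((4 : ℝ) + 1) ^ 2 * ((4 : ℝ) + 4) ^ 2 * (L : ℝ) ^ 2 * b' ≤ 1 →
      23040 * (4 : ℝ) ^ 4 * (frameC 4 L + 4) ^ 3 * (c' + curConst 4 L * b' ^ 2) ≤ 1 →
      ∀ ⦃α : ℝ⦄, 0 < α → C0 4 * α ≤ 1 / 3 → 2 * α ≤ c2' 4 L → 11 * (4 : ℝ) ^ 2 * α ≤ 1 / 6 → α + 11 * (4 : ℝ) ^ 2 * α ≤ c₁' →
      b' + 226 * (8 * ((4 : ℝ) + 1) * ((4 : ℝ) + 4)) ^ 2 * b' ^ 2 < α → 4 * ((4 : ℝ) - 1) * (c' + curConst 4 L * b' ^ 2) < α →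
      ∀ ⦃Mc : ℝ⦄, 0 ≤ Mc → (Mc + 1) * (b' + 226 * (8 * ((4 : ℝ) + 1) * ((4 : ℝ) + 4)) ^ 2 * b' ^ 2) ≤ 1 / 2 →
      ∀ (𝒬 : ℕ → Set (Set (Site 4) × ℕ)), (∀ k, ∀ q ∈ 𝒬 k, q.2 ≤ k ∧ ∃ y : Site 4, ∀ z ∈ q.1, (l1 (z - y) : ℝ) ≤ Mc * (L : ℝ) ^ q.2) →
      ∀ ⦃C335 : ℝ⦄, 2 * (Mc + 1) * (b' + 226 * (8 * ((4 : ℝ) + 1) * ((4 : ℝ) + 4)) ^ 2 * b' ^ 2) + 2 * Mc * (2 * (c' + curConst 4 L * b' ^ 2)) +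
        4 * Mc * (1 + 2 * Mc) * (b' + 226 * (8 * ((4 : ℝ) + 1) * ((4 : ℝ) + 4)) ^ 2 * b' ^ 2) ^ 2 < C335 →
      ∀ ⦃ε s₁ b s₂ : ℝ⦄, 0 < ε → ε ≤ r → ε < α → 0 ≤ s₁ → s₁ ≤ r → 0 ≤ b → b ≤ ε / 2 →
      5 * ((4 : ℕ) : ℝ) * L * inp.B₀ * (α + 11 * (4 : ℝ) ^ 2 * α) ≤ s₁ →
      5 * ((4 : ℕ) : ℝ) * L * inp.B₀ * (α + 11 * (4 : ℝ) ^ 2 * α) +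
          2 * (b' + 226 * (8 * ((4 : ℝ) + 1) * ((4 : ℝ) + 4)) ^ 2 * b' ^ 2) * s₁ ≤ s₁ →
      5 * ((4 : ℕ) : ℝ) * L * inp.B₀ * (α + 11 * (4 : ℝ) ^ 2 * α) + 16 * (b' + 226 * (8 * ((4 : ℝ) + 1) * ((4 : ℝ) + 4)) ^ 2 * b' ^ 2) *
          (5 * ((4 : ℕ) : ℝ) * L * inp.B₀ * (α + 11 * (4 : ℝ) ^ 2 * α)) ≤ s₁ →
      5 * ((4 : ℕ) : ℝ) * L * B₀β * (α + 11 * (4 : ℝ) ^ 2 * α) + 10 * (b' + 226 * (8 * ((4 : ℝ) + 1) * ((4 : ℝ) + 4)) ^ 2 * b' ^ 2) *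
          (5 * ((4 : ℕ) : ℝ) * L * inp.B₀ * (α + 11 * (4 : ℝ) ^ 2 * α)) ≤ s₂ →
      ∀ {dom : _root_.Set (Site 4 → Fin 4 → (Matrix n n ℂ)ˣ)},
        LeafH3sup 4 L N ε b' c' dom →
        CovRootHolderMS 4 (sfClass 4 L N ε) L N b g C s₁ s₂ β dom := by
  letI : CStarAlgebra (Matrix n n ℂ) := {}
  obtain ⟨r, hr0, hr⟩ := n16_holderMS_of_leaf (n := n) hL hN
  refine ⟨r, hr0, fun g hg => ?_⟩
  obtain ⟨C, hC0, hC⟩ := hr hg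
  refine ⟨C, hC0, fun β hβ0 hβ1 C₂ B₀ B₀' cu cF₀ cF c59 cu' cP inp B₀β hB₀ hiB hB₀' hB hcu hcF₀ hcF hc59 hcu' hcP hB₀β hC₂ SHFP₀ SHFP SH59
    SP5u SB9 => ?_⟩
  -- node N05's Theorem 4 ∕ Proposition 3 on the univ sub-family from the sockets there (n05-a, `ι := Subtype.val`)
  obtain ⟨c₁t, hc₁t, hT⟩ := B8LeafKnitZd3E.thm4Printed_zd3_of_HFP₄_mapE (𝔸 := Matrix n n ℂ) (d := 4) (by norm_num) hL (β := β)
    (len := l1Len) hB₀ hB₀' hB hcu hcF₀ hcF hc59 hcu' (fun i : {i : ZdIdx 4 L // i.Ω 0 = Set.univ} => i.1) SHFP₀ SHFP SH59 SP5u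
  obtain ⟨cP', hcP', hP⟩ := B8LeafModelZd3Map.prop3Printed_zd3_map (𝔸 := Matrix n n ℂ) (d := 4) (by norm_num) hL inp hB₀β hC₂ hcP
    β l1Len (fun i : {i : ZdIdx 4 L // i.Ω 0 = Set.univ} => i.1) SB9
  -- the letter `B₁′ := 5·4·L·B₀` and the window threshold below the two printed thresholds
  have hLpos : (0 : ℝ) < L := by exact_mod_cast (show 0 < L by omega)
  have hB₁' : 0 < 5 * ((4 : ℕ) : ℝ) * L * B₀ := by positivity
  have hBB : 5 * ((4 : ℕ) : ℝ) * L * inp.B₀ ≤ 5 * ((4 : ℕ) : ℝ) * L * B₀ := mul_le_mul_of_nonneg_left hiB (by positivity)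
  obtain ⟨c₁', hc₁', hwin⟩ := exists_window_print (d := 4) (L := L) (by norm_num) hL C₂ hc₁t hcP' hB₁'
  have h16 : 16 * (5 * ((4 : ℕ) : ℝ) * L * inp.B₀ * c₁') ≤ 1 := by
    obtain ⟨-, -, -, h, -⟩ := hwin (c₁' / 2) (c₁' / 2) (by linarith) (by linarith) (by linarith)
    have h' : 16 * (5 * ((4 : ℕ) : ℝ) * L * B₀ * c₁') ≤ 1 := by rwa [add_halves] at h
    nlinarith [mul_le_mul_of_nonneg_right hBB hc₁'.le]
  refine ⟨c₁', hc₁', h16, fun b' c' hb' hc' hRb hcF α hα hA3 hA2 hAs hAc hb'α hc'α Mc hMc hMcα 𝒬 h𝒬 C335 hC335 ε s₁ b s₂ hε hεr hεα hs₁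
    hs₁r hb hbh hss hgrad hℓ hhol dom h3 => ?_⟩
  exact hC c₁t c₁' (5 * ((4 : ℕ) : ℝ) * L * B₀) cP' C₂ B₀β inp l1Len (fun v hv => one_le_l1Len hv) l1Len_nsmul_e hB₁' hBB h16 hwin hb' hc'
    hRb hcF hα hA3 hA2 hAs hAc hb'α hc'α hMc hMcα 𝒬 h𝒬 hC335 hε hεr hεα hs₁ hs₁r hb hbh hss hgrad hℓ hhol hβ0 hβ1 hT hP h3

end Matrices

end

end Summit.QuantumFields.YangMills.BalabanUVNodes.N16OfSocketsZd3
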